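import Literature.MathematicalPhysics.QuantumFieldTheory.Balaban1983to89.B15Prop1LocalChartAtBaseField
import Literature.MathematicalPhysics.QuantumFieldTheory.Balaban1983to89.B15Prop1HessianNondegenerateOfRealCoercive

/-!
# `Balaban1983to89.B15Prop1SliceNondegeneracyFromRealCoercive` — [Balaban1989LargeFieldII] = «[LF-II]», (1.9) p. 358, (1.12) p. 359, p. 359 («positive, hence invertible on this
# subspace. Thus we can apply the implicit function theorem»); [Balaban1985Variational] = «[15]», Sect. G pp. 305–307, (181) p. 307, Prop. 9 (190) p. 309:
# THE (β) LETTER `hnondeg` OF THE w1 LINEAGE ON A GAUGE SLICE, FROM POSITIVITY OF THE REAL SECOND VARIATION OF THE WILSON ACTION ALONG REAL SLICE FIELDS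

Honest framing: statement-level skeleton of published theorems with citation tags; proofs where landed; nothing here is a claim about the
Yang–Mills mass gap.  Cell `pub-ymgap`, HUMAN RULING D-0149 (width seats), seat `pub-ymgap-dag-n12-w1` (g2; N12 = [B15]; U1a⁺ of the w1 lineage);
count-neutral; N12 NOT discharged; finite 𝕋⁴ at fixed ε; nothing continuum ∕ OS ∕ mass-gap ∕ Clay.

WHY.  `B15Prop1LocalChartAtBaseField.exists_localChart_at_baseField` ∕ `B15Prop1MinimiserFamilyFromRightInverse.hMin_[atRecord_]of_rightInverseLetters` (this seat) take, per
base field, the COMPLEX nondegeneracy letter (β) on the conjugation-stable gauge slice `S ≤ (PBond P 0 → ℂ³)`: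

  `hnondeg : ∀ s : S, DΦ₀(0) s = 0 → (∀ t : S, DΦ₀(0) t = 0 → D²a(0)(s,t) − ℓ₀ (D²Φ₀(0)(s,t)) = 0) → s = 0`,

where `a X = A(expMulC X ↑U₀)` is the complex Wilson action and `Φ₀ X = κ(expMulC X ↑U₀)` the logarithmic datum coordinates in the state chart centred at the base minimiser `U₀`.
Seat n12-w2's generic `LagrangeHessianRealCoercive.hnondeg_of_re_pos` reduces such a letter, on ANY complex space with a conjugation, to positivity of the real part of the diagonal
Lagrange Hessian on non-zero REAL kernel vectors (symmetry of second derivatives does the rest); its N12 edition `B15Prop1HessianNondegenerateOfRealCoercive` is written on the FULL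
coordinate space.  THIS MODULE is the edition ON THE SLICE `S` of the w1 lineage, in the currency the (β) estimates of the sibling lanes produce
(`B16Ineq19NearFlatSlice.h17_nearFlat`, `B16Ineq17NearFlatOneSided.lagrangeHessian_ge_flatMin_sub`, `Node00.WilsonActionSecondVariation…`): the real vectors of `S` are the
`cplxVec p` with `cplxVec p ∈ S` (`conjVec_eq_self_iff`), the complex action restricted to the real chart line `t ↦ (t : ℂ) • cplxVec p` IS `t ↦ wilsonAction4 (exp(t p)·U₀)`
(`actionSum_expMulC_cplxVec`), and so (β) on `S` follows from

  `0 < d²∕dt² [ wilsonAction4 (expMul su2Chart (t • p) U₀) − Re ℓ₀ (Φ₀ ((t : ℂ) • cplxVec p)) ] |_{t=0}`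

for every non-zero real slice field `p` in the kernel of the linearised constraint.  The local conjugation-equivariance of `Φ₀` needed by the generic lemma is INHABITED here from
`eventually_datumCoord_theta` and `expMulC_conjVec_coeField` (as in `exists_localChart_at_baseField`); the regularity from `analyticAt_actionSum_expMulC`,
`eventually_analyticAt_datumCoord`, `analyticAt_expMulC_right`.

CONTENTS (theorems only; no `def`, no `instance`, no `sorry`).  §1 `smul_coe_cplxVec` (the real chart line inside the slice), `analyticAt_sliceAction`, `sliceAction_realLine`
(`a ((t:ℂ) • ⟨cplxVec p, _⟩) = ↑(wilsonAction4 (expMul su2Chart (t • p) U₀))`), `eventually_sliceDatum_conj` (local conjugation-equivariance of `Φ₀` on the slice),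
`analyticAt_sliceDatum`, `fderiv_sliceDatum_apply_eq_deriv` (the kernel condition in line currency).  §2 ★★★ `hnondeg_slice_of_realSecondVariation_pos`.  §3 (stationary base,
e.g. the flat one) `hasDerivAt_wilsonAction4_realLine`, `fderiv_sliceAction_apply_cplxVec` (`Da(0)⟨cplxVec p,_⟩ = ↑(d∕ds wilsonAction4(exp(s p)·U₀)|₀)`),
★ `fderiv_sliceAction_eq_zero_of_isLocalMin`, `isLocalMin_realLine_of_forall_le`, `multiplier_eq_zero_of_fderiv_eq_zero`, ★★ `hnondeg_slice_of_secondVariation_pos_of_isLocalMin`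
((β) for all multipliers ⇐ stationarity + onto + `0 < d²∕dt² wilsonAction4 (expMul su2Chart (t • p) U₀)|₀` on the real kernel).
HONEST SCOPE: bookkeeping over n12-w2's generic junction; the real coercivity ESTIMATE itself ((β): [LF-II] (1.9) at the background — the sibling lanes' files), the right-inverse
letter, the criticality transfer and [15] Thm 1's clauses remain DISPLAYED where they are; nothing of Bałaban's is asserted; count-neutral; N12 NOT discharged; the YM mass gap (Clay)
is NOT proved by any of this — R4 closes only the conditional finite-𝕋⁴ rung `BalabanLadder.UV`.
-/

noncomputable section

namespace Literature.MathematicalPhysics.QuantumFieldTheory.Balaban1983to89.B15Prop1SliceNondegeneracyFromRealCoercive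

open Set Metric Filter
open scoped Topology ContDiff ComplexConjugate
open Literature.Analysis.Calculus.LagrangeHessianRealCoercive (hnondeg_of_re_pos deriv_deriv_re_comp_realLine fderiv_fderiv_lagrangian_apply hasDerivAt_comp_realLine
  two_le_add_one_of_ne_zero_withTop)
open Literature.Analysis.Calculus.ConstrainedCriticalFamily (killsKer_of_real)
open Literature.MathematicalPhysics.QuantumFieldTheory.Balaban1983to89.Node00 (SU coeField coeField_apply SmallBelow ConstrSet constrCard constrEnum)
open B15AveragingHolomorphic (iterMh)
open B15ComplexifiedDatumFamily (conjVec conjVec_cplxVec)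
open B15SU2ChartHolomorphic (expMulC logCoordC)
open B15Prop1StateChartSU2 (exists_conjCLM_pi conjVec_conjVec conjVec_eq_self_iff expMulC_conjVec_coeField det_expMulC_coeField analyticAt_expMulC_right
  expMulC_cplxVec_coeField_eq)
open B15Prop1DatumCoordinates (eventually_analyticAt_datumCoord eventually_datumCoord_theta expMulC_zero_left)
open B15Prop1ComplexWilsonAction (analyticAt_actionSum_expMulC actionSum_expMulC_cplxVec)
open B15Prop1LocalChartAtBaseField (exists_conjCLM_submodule)
open B15Prop1HessianNondegenerateOfRealCoercive (cplxVec_smul)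
open B15Prop1AnalyticExtClause (cplxVec)
open B15Prop1ChartCalculusSU2 (E3)
open B15Prop1ChartSU2 (su2Chart)
open B16Sect1Backgrounds (expMul)
open ExpMeanLog (expMeanLogSU)
open BlockAveraging (blockAvg)
open T4CubeChartGnomonic (SU2)
open T4Continuum B15DeterminingSets GaugeField
open scoped Matrix.Norms.L2Operator

variable {P : Params}

/-! ## §1  The slice action and the slice datum coordinates along real slice fields -/

section Slice

variable (S : Submodule ℂ (VecField P 0 (EuclideanSpace ℂ (Fin 3))))

/-- The real chart line inside the slice: `(((t : ℂ) • X : S) : E) = cplxVec (t • p)` when `(X : E) = cplxVec p`. [cite: Balaban1989LargeFieldI, Prop. 1 p.194 («B′ ∈ 𝔤ᶜ»; bookkeeping)] -/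
theorem smul_coe_cplxVec {p : VecField P 0 E3} (hp : cplxVec p ∈ S) (t : ℝ) :
    (((t : ℂ) • (⟨cplxVec p, hp⟩ : S) : S) : VecField P 0 (EuclideanSpace ℂ (Fin 3))) = cplxVec (t • p) := by
  rw [Submodule.coe_smul, cplxVec_smul]

variable {U₀ : GaugeField P 0 SU2} {a : S → ℂ}
  (ha : ∀ X : S, a X = ∑ q : Plaq P 0, (1 - (expMulC (X : VecField P 0 (EuclideanSpace ℂ (Fin 3))) (coeField U₀) ⟨q.src, q.μ⟩ *
    expMulC (X : VecField P 0 (EuclideanSpace ℂ (Fin 3))) (coeField U₀) ⟨q.src.shift q.μ, q.ν⟩ *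
    Matrix.adjugate (expMulC (X : VecField P 0 (EuclideanSpace ℂ (Fin 3))) (coeField U₀) ⟨q.src.shift q.ν, q.μ⟩) *
    Matrix.adjugate (expMulC (X : VecField P 0 (EuclideanSpace ℂ (Fin 3))) (coeField U₀) ⟨q.src, q.ν⟩)).trace / 2))
include ha

/-- **THE SLICE ACTION IS ANALYTIC** (a trace polynomial of the analytic state chart). [cite: Balaban1985Variational, Sect. G p.307 («the equations … are valid for Gᶜ-valued fields»); Balaban1989LargeFieldI, Prop. 1 p.194] -/
theorem analyticAt_sliceAction (X : S) : AnalyticAt ℂ a X := by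
  have hfun : a = fun X : S => ∑ q : Plaq P 0, (1 - (expMulC (X : VecField P 0 (EuclideanSpace ℂ (Fin 3))) (coeField U₀) ⟨q.src, q.μ⟩ *
      expMulC (X : VecField P 0 (EuclideanSpace ℂ (Fin 3))) (coeField U₀) ⟨q.src.shift q.μ, q.ν⟩ *
      Matrix.adjugate (expMulC (X : VecField P 0 (EuclideanSpace ℂ (Fin 3))) (coeField U₀) ⟨q.src.shift q.ν, q.μ⟩) *
      Matrix.adjugate (expMulC (X : VecField P 0 (EuclideanSpace ℂ (Fin 3))) (coeField U₀) ⟨q.src, q.ν⟩)).trace / 2) := funext ha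
  rw [hfun]
  exact (analyticAt_actionSum_expMulC (P := P) (j := 0) (A := fun W => ∑ q : Plaq P 0, (1 - (W ⟨q.src, q.μ⟩ * W ⟨q.src.shift q.μ, q.ν⟩ *
    Matrix.adjugate (W ⟨q.src.shift q.ν, q.μ⟩) * Matrix.adjugate (W ⟨q.src, q.ν⟩)).trace / 2)) (fun _ => rfl) U₀ _).comp (S.subtypeL.analyticAt X)

/-- **THE SLICE ACTION ON THE REAL CHART LINE IS THE WILSON ACTION**: `a ((t:ℂ) • cplxVec p) = ↑(wilsonAction4 (expMul su2Chart (t • p) U₀))`.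
[cite: Balaban1989LargeFieldII, (1.12) p.359; Balaban1985Variational, (2) p.278, Sect. G p.305] -/
theorem sliceAction_realLine {p : VecField P 0 E3} (hp : cplxVec p ∈ S) (t : ℝ) :
    a ((t : ℂ) • ⟨cplxVec p, hp⟩) = ((wilsonAction4 (expMul su2Chart (t • p) U₀) : ℝ) : ℂ) := by
  rw [ha, smul_coe_cplxVec S hp t]
  exact actionSum_expMulC_cplxVec (A := fun W => ∑ q : Plaq P 0, (1 - (W ⟨q.src, q.μ⟩ * W ⟨q.src.shift q.μ, q.ν⟩ *
    Matrix.adjugate (W ⟨q.src.shift q.ν, q.μ⟩) * Matrix.adjugate (W ⟨q.src, q.ν⟩)).trace / 2)) (fun _ => rfl) U₀ _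

omit ha in
/-- **LOCAL CONJUGATION-EQUIVARIANCE OF THE SLICE DATUM COORDINATES**: with `cE` the conjugation of the stable slice (acting as `conjVec`) and `cF` coordinatewise conjugation,
`Φ₀ (cE X) = cF (Φ₀ X)` for `X` near `0` — from the `θ`-covariance of the logarithmic coordinates near the base (`eventually_datumCoord_theta`) and of the state chart
(`expMulC_conjVec_coeField`). [cite: Balaban1985Variational, Sect. G p.307, (181) p.307; Balaban1989LargeFieldI, Prop. 1 p.194 (last clause: «real for real arguments»)] -/
theorem eventually_sliceDatum_conj (𝔹 : DetSet P) (k : ℕ) (W : MSField P SU2)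
    (hsbU : SmallBelow (fun j => blockAvg (P := P) (j := j) expMeanLogSU) k U₀)
    (hU₀ : AgreeOn 𝔹 (avgFamily (fun j => blockAvg (P := P) (j := j) expMeanLogSU) U₀) W)
    {Φ₀ : S → Fin (constrCard 𝔹 k) → EuclideanSpace ℂ (Fin 3)}
    (hΦ₀ : ∀ (X : S) i, Φ₀ X i = logCoordC (star ((W ((constrEnum 𝔹 k).symm i).1 ((constrEnum 𝔹 k).symm i).2.1 : SU2) : Matrix (Fin 2) (Fin 2) ℂ) *
      iterMh ((constrEnum 𝔹 k).symm i).1 (expMulC (X : VecField P 0 (EuclideanSpace ℂ (Fin 3))) (coeField U₀)) ((constrEnum 𝔹 k).symm i).2.1))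
    {cE : S →L⋆[ℂ] S} (hcE : ∀ X : S, ((cE X : S) : VecField P 0 (EuclideanSpace ℂ (Fin 3))) = conjVec (X : VecField P 0 (EuclideanSpace ℂ (Fin 3))))
    {cF : (Fin (constrCard 𝔹 k) → EuclideanSpace ℂ (Fin 3)) →L⋆[ℂ] (Fin (constrCard 𝔹 k) → EuclideanSpace ℂ (Fin 3))} (hcF : ∀ v i b, cF v i b = conj (v i b)) :
    ∀ᶠ X in 𝓝 (0 : S), Φ₀ (cE X) = cF (Φ₀ X) := by
  set κ : (PBond P 0 → Matrix (Fin 2) (Fin 2) ℂ) → Fin (constrCard 𝔹 k) → EuclideanSpace ℂ (Fin 3) := fun Q i =>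
    logCoordC (star ((W ((constrEnum 𝔹 k).symm i).1 ((constrEnum 𝔹 k).symm i).2.1 : SU2) : Matrix (Fin 2) (Fin 2) ℂ) *
      iterMh ((constrEnum 𝔹 k).symm i).1 Q ((constrEnum 𝔹 k).symm i).2.1) with hκdef
  have hκ : ∀ Q i, κ Q i = logCoordC (star ((W ((constrEnum 𝔹 k).symm i).1 ((constrEnum 𝔹 k).symm i).2.1 : SU2) : Matrix (Fin 2) (Fin 2) ℂ) *
      iterMh ((constrEnum 𝔹 k).symm i).1 Q ((constrEnum 𝔹 k).symm i).2.1) := fun Q i => rfl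
  set χ : S → PBond P 0 → Matrix (Fin 2) (Fin 2) ℂ := fun X => expMulC (X : VecField P 0 (EuclideanSpace ℂ (Fin 3))) (coeField U₀) with hχdef
  have hχ0 : χ 0 = coeField U₀ := by
    show expMulC ((0 : S) : VecField P 0 (EuclideanSpace ℂ (Fin 3))) (coeField U₀) = coeField U₀
    rw [Submodule.coe_zero, expMulC_zero_left]
  have hχcont : ContinuousAt χ 0 := ((analyticAt_expMulC_right (coeField U₀) _).comp (S.subtypeL.analyticAt 0)).continuousAt
  have hχt : Tendsto χ (𝓝 0) (𝓝 (coeField U₀)) := by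
    have h := hχcont.tendsto; rwa [hχ0] at h
  have hχθ : ∀ (X : S) b, χ (cE X) b = (star (χ X b))⁻¹ := fun X b => by
    show expMulC ((cE X : S) : VecField P 0 (EuclideanSpace ℂ (Fin 3))) (coeField U₀) b = _
    rw [hcE]
    exact expMulC_conjVec_coeField U₀ _ b
  have hχdet : ∀ (X : S) b, (χ X b).det = 1 := fun X b => det_expMulC_coeField U₀ _ b
  have hΦ₀κ : ∀ X : S, Φ₀ X = κ (χ X) := fun X => funext fun i => by rw [hΦ₀, hκ]
  have hκθ : ∀ᶠ Q in 𝓝 (coeField U₀), (∀ b, IsUnit (Q b).det) → κ (fun b => (star (Q b))⁻¹) = cF (κ Q) :=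
    eventually_datumCoord_theta 𝔹 k W κ hκ hsbU hU₀ cF hcF
  filter_upwards [hχt.eventually hκθ] with X hX
  rw [hΦ₀κ, hΦ₀κ]
  have hunit : ∀ b, IsUnit (χ X b).det := fun b => by rw [hχdet]; exact isUnit_one
  have h := hX hunit
  have hfun : χ (cE X) = fun b => (star (χ X b))⁻¹ := funext (hχθ X)
  rw [hfun]
  exact h

omit ha in
/-- **THE SLICE DATUM COORDINATES ARE ANALYTIC AT THE BASE** (logarithmic coordinates analytic near the base datum, state chart analytic). [cite: Balaban1985Variational, Sect. G p.307; Balaban1989LargeFieldI, Prop. 1 p.194] -/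
theorem analyticAt_sliceDatum (𝔹 : DetSet P) (k : ℕ) (W : MSField P SU2)
    (hsbU : SmallBelow (fun j => blockAvg (P := P) (j := j) expMeanLogSU) k U₀)
    (hU₀ : AgreeOn 𝔹 (avgFamily (fun j => blockAvg (P := P) (j := j) expMeanLogSU) U₀) W)
    {Φ₀ : S → Fin (constrCard 𝔹 k) → EuclideanSpace ℂ (Fin 3)}
    (hΦ₀ : ∀ (X : S) i, Φ₀ X i = logCoordC (star ((W ((constrEnum 𝔹 k).symm i).1 ((constrEnum 𝔹 k).symm i).2.1 : SU2) : Matrix (Fin 2) (Fin 2) ℂ) *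
      iterMh ((constrEnum 𝔹 k).symm i).1 (expMulC (X : VecField P 0 (EuclideanSpace ℂ (Fin 3))) (coeField U₀)) ((constrEnum 𝔹 k).symm i).2.1)) :
    AnalyticAt ℂ Φ₀ 0 := by
  set κ : (PBond P 0 → Matrix (Fin 2) (Fin 2) ℂ) → Fin (constrCard 𝔹 k) → EuclideanSpace ℂ (Fin 3) := fun Q i =>
    logCoordC (star ((W ((constrEnum 𝔹 k).symm i).1 ((constrEnum 𝔹 k).symm i).2.1 : SU2) : Matrix (Fin 2) (Fin 2) ℂ) *
      iterMh ((constrEnum 𝔹 k).symm i).1 Q ((constrEnum 𝔹 k).symm i).2.1) with hκdef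
  have hκ : ∀ Q i, κ Q i = logCoordC (star ((W ((constrEnum 𝔹 k).symm i).1 ((constrEnum 𝔹 k).symm i).2.1 : SU2) : Matrix (Fin 2) (Fin 2) ℂ) *
      iterMh ((constrEnum 𝔹 k).symm i).1 Q ((constrEnum 𝔹 k).symm i).2.1) := fun Q i => rfl
  set χ : S → PBond P 0 → Matrix (Fin 2) (Fin 2) ℂ := fun X => expMulC (X : VecField P 0 (EuclideanSpace ℂ (Fin 3))) (coeField U₀) with hχdef
  have hχ0 : χ 0 = coeField U₀ := by
    show expMulC ((0 : S) : VecField P 0 (EuclideanSpace ℂ (Fin 3))) (coeField U₀) = coeField U₀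
    rw [Submodule.coe_zero, expMulC_zero_left]
  have hχan : AnalyticAt ℂ χ 0 := (analyticAt_expMulC_right (coeField U₀) _).comp (S.subtypeL.analyticAt 0)
  have hfun : Φ₀ = fun X : S => κ (χ X) := funext fun X => funext fun i => by rw [hΦ₀, hκ]
  rw [hfun]
  have hκan : ∀ᶠ Q in 𝓝 (coeField U₀), AnalyticAt ℂ κ Q := eventually_analyticAt_datumCoord 𝔹 k W κ hκ hsbU hU₀
  have h1 : AnalyticAt ℂ κ (χ 0) := by rw [hχ0]; exact hκan.self_of_nhds
  exact h1.comp hχan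

omit ha in
/-- **THE KERNEL CONDITION IN LINE CURRENCY**: for `Φ₀` differentiable at `0`, `DΦ₀(0) ⟨cplxVec p, _⟩ = d∕dt Φ₀ ((t:ℂ) • ⟨cplxVec p, _⟩)|₀` — «`p` is in the kernel of the
linearised constraint» reads: the logarithmic datum coordinates are stationary along the real chart line of `p`. [cite: Balaban1985Variational, Sect. G p.305, (181) p.307; LuenbergerYe2008, §10.7 pp.306–307] -/
theorem fderiv_sliceDatum_apply_eq_deriv {F : Type*} [NormedAddCommGroup F] [NormedSpace ℂ F] {Φ₀ : S → F} (hΦ₀ : DifferentiableAt ℂ Φ₀ 0)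
    {p : VecField P 0 E3} (hp : cplxVec p ∈ S) :
    fderiv ℂ Φ₀ 0 ⟨cplxVec p, hp⟩ = deriv (fun t : ℝ => Φ₀ ((t : ℂ) • ⟨cplxVec p, hp⟩)) 0 := by
  have h := hasDerivAt_comp_realLine (x₀ := (0 : S)) (⟨cplxVec p, hp⟩ : S) hΦ₀
  simp only [zero_add] at h
  exact h.deriv.symm

end Slice

/-! ## §2  (β) on the slice from positivity of the real second variation -/

section Letter

/-- ★★★ **THE (β) LETTER `hnondeg` ON A GAUGE SLICE FROM POSITIVITY OF THE REAL SECOND VARIATION ALONG REAL SLICE FIELDS.**  Objects: a conjugation-stable slice `S`; the base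
configuration `U₀` with the guards `SmallBelow … k U₀`, `AgreeOn 𝔹 (avgFamily av U₀) W` (the logarithmic coordinates are taken relative to the base datum `W`); the slice action
`a` and slice datum coordinates `Φ₀`, characterised pointwise EXACTLY as in `B15Prop1LocalChartAtBaseField.exists_localChart_at_baseField`; any `ℓ₀`.  HYPOTHESIS (the real
(β) estimate, [LF-II] (1.9) read at the background): for every real bond field `p ≠ 0` with `cplxVec p ∈ S` in the kernel of the linearised constraint (`DΦ₀(0) ⟨cplxVec p, _⟩ = 0`),

  `0 < d²∕dt² [ wilsonAction4 (expMul su2Chart (t • p) U₀) − Re ℓ₀ (Φ₀ ((t:ℂ) • ⟨cplxVec p, _⟩)) ] |_{t=0}`.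

CONCLUSION: the letter `hnondeg` of `exists_localChart_at_baseField` ∕ `hMin_of_rightInverseLetters` for this `ℓ₀`, VERBATIM.  Proof: n12-w2's `hnondeg_of_re_pos` on `E := S`
with the slice conjugation; its local equivariance input is `eventually_sliceDatum_conj`, its regularity inputs `analyticAt_sliceAction` ∕ `analyticAt_sliceDatum`; a real
vector of `S` is `cplxVec p` (`conjVec_eq_self_iff`); the diagonal Hessian's real part is the second derivative of the real restriction (`deriv_deriv_re_comp_realLine`,
`fderiv_fderiv_lagrangian_apply`), and the real restriction of `a` is the Wilson action (`sliceAction_realLine`).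
[cite: Balaban1989LargeFieldII, (1.9) p.358, (1.12) p.359, p.359 («positive, hence invertible on this subspace. Thus we can apply the implicit function theorem»); Balaban1985Variational, Sect. G pp.305–307, (181) p.307, Prop. 9 (190) p.309; Balaban1989LargeFieldI, Prop. 1 p.194 (last clause); LuenbergerYe2008, §10.7 p.307, §11.5] -/
theorem hnondeg_slice_of_realSecondVariation_pos (𝔹 : DetSet P) (k : ℕ) (W : MSField P SU2) {U₀ : GaugeField P 0 SU2}
    (hsbU : SmallBelow (fun j => blockAvg (P := P) (j := j) expMeanLogSU) k U₀)
    (hU₀ : AgreeOn 𝔹 (avgFamily (fun j => blockAvg (P := P) (j := j) expMeanLogSU) U₀) W)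
    (S : Submodule ℂ (VecField P 0 (EuclideanSpace ℂ (Fin 3)))) (hS : ∀ X ∈ S, conjVec X ∈ S)
    (a : S → ℂ)
    (ha : ∀ X : S, a X = ∑ q : Plaq P 0, (1 - (expMulC (X : VecField P 0 (EuclideanSpace ℂ (Fin 3))) (coeField U₀) ⟨q.src, q.μ⟩ *
      expMulC (X : VecField P 0 (EuclideanSpace ℂ (Fin 3))) (coeField U₀) ⟨q.src.shift q.μ, q.ν⟩ *
      Matrix.adjugate (expMulC (X : VecField P 0 (EuclideanSpace ℂ (Fin 3))) (coeField U₀) ⟨q.src.shift q.ν, q.μ⟩) *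
      Matrix.adjugate (expMulC (X : VecField P 0 (EuclideanSpace ℂ (Fin 3))) (coeField U₀) ⟨q.src, q.ν⟩)).trace / 2))
    (Φ₀ : S → Fin (constrCard 𝔹 k) → EuclideanSpace ℂ (Fin 3))
    (hΦ₀ : ∀ (X : S) i, Φ₀ X i = logCoordC (star ((W ((constrEnum 𝔹 k).symm i).1 ((constrEnum 𝔹 k).symm i).2.1 : SU2) : Matrix (Fin 2) (Fin 2) ℂ) *
      iterMh ((constrEnum 𝔹 k).symm i).1 (expMulC (X : VecField P 0 (EuclideanSpace ℂ (Fin 3))) (coeField U₀)) ((constrEnum 𝔹 k).symm i).2.1))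
    (ℓ₀ : (Fin (constrCard 𝔹 k) → EuclideanSpace ℂ (Fin 3)) →L[ℂ] ℂ)
    -- the REAL (β) estimate along real slice fields in the kernel of the linearised constraint
    (hpos : ∀ (p : VecField P 0 E3) (hp : cplxVec p ∈ S), p ≠ 0 → fderiv ℂ Φ₀ 0 ⟨cplxVec p, hp⟩ = 0 →
      0 < deriv (deriv (fun t : ℝ => wilsonAction4 (expMul su2Chart (t • p) U₀) - (ℓ₀ (Φ₀ ((t : ℂ) • ⟨cplxVec p, hp⟩))).re)) 0) :
    ∀ s : S, fderiv ℂ Φ₀ 0 s = 0 →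
      (∀ t : S, fderiv ℂ Φ₀ 0 t = 0 → fderiv ℂ (fderiv ℂ a) 0 s t - ℓ₀ (fderiv ℂ (fderiv ℂ Φ₀) 0 s t) = 0) → s = 0 := by
  -- the conjugations
  obtain ⟨cE, hcE, hcEinv⟩ := exists_conjCLM_submodule S hS
  obtain ⟨cF, hcF, hcFinv⟩ := exists_conjCLM_pi (Fin (constrCard 𝔹 k))
  -- regularity and local equivariance
  have ha2 : ContDiffAt ℂ ((1 : WithTop ℕ∞) + 1) a 0 := (analyticAt_sliceAction S ha 0).contDiffAt
  have hΦ2 : ContDiffAt ℂ ((1 : WithTop ℕ∞) + 1) Φ₀ 0 := (analyticAt_sliceDatum S 𝔹 k W hsbU hU₀ hΦ₀).contDiffAt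
  have hloc : ∀ᶠ X in 𝓝 (0 : S), Φ₀ (cE X) = cF (Φ₀ X) := eventually_sliceDatum_conj S 𝔹 k W hsbU hU₀ hΦ₀ hcE hcF
  have hx₀ : cE 0 = 0 := map_zero cE
  have hn : (2 : WithTop ℕ∞) ≤ (1 : WithTop ℕ∞) + 1 := two_le_add_one_of_ne_zero_withTop one_ne_zero
  have hL : ContDiffAt ℂ ((1 : WithTop ℕ∞) + 1) (fun X => a X - ℓ₀ (Φ₀ X)) 0 := ha2.sub (ℓ₀.contDiff.contDiffAt.comp _ hΦ2)
  refine hnondeg_of_re_pos cE cF (m := 1) one_ne_zero ℓ₀ ha2 hΦ2 hcEinv hcFinv hx₀ hloc fun u hu hker hne => ?_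
  -- a non-zero real vector of the slice is `cplxVec p`, `p ≠ 0`
  have hureal : conjVec (u : VecField P 0 (EuclideanSpace ℂ (Fin 3))) = (u : VecField P 0 (EuclideanSpace ℂ (Fin 3))) := by
    rw [← hcE, hu]
  obtain ⟨p, hp⟩ := (conjVec_eq_self_iff _).1 hureal
  have hpS : cplxVec p ∈ S := by rw [← hp]; exact u.2
  have hu' : u = ⟨cplxVec p, hpS⟩ := Subtype.ext hp
  have hpne : p ≠ 0 := by
    rintro rfl
    apply hne
    rw [hu']
    apply Subtype.ext
    show cplxVec (0 : VecField P 0 E3) = 0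
    funext b; ext i; simp [cplxVec]
  subst hu'
  -- the diagonal Hessian's real part is the second derivative of the real restriction, which is the displayed real letter
  have h := hpos p hpS hpne hker
  have hfun : (fun t : ℝ => wilsonAction4 (expMul su2Chart (t • p) U₀) - (ℓ₀ (Φ₀ ((t : ℂ) • ⟨cplxVec p, hpS⟩))).re) =
      fun t : ℝ => ((fun X => a X - ℓ₀ (Φ₀ X)) ((0 : S) + (t : ℂ) • ⟨cplxVec p, hpS⟩)).re := by
    funext t
    rw [zero_add, Complex.sub_re, sliceAction_realLine S ha hpS t, Complex.ofReal_re]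
  rw [hfun, deriv_deriv_re_comp_realLine (⟨cplxVec p, hpS⟩ : S) hL hn, fderiv_fderiv_lagrangian_apply ℓ₀ ha2 hΦ2 hn] at h
  exact h

end Letter

/-! ## §3  At a base configuration STATIONARY for the Wilson action along real slice lines (e.g. the flat base): the multiplier vanishes and (β) is positivity of the
pure second variation -/

section Stationary

variable (S : Submodule ℂ (VecField P 0 (EuclideanSpace ℂ (Fin 3)))) {U₀ : GaugeField P 0 SU2} {a : S → ℂ}
  (ha : ∀ X : S, a X = ∑ q : Plaq P 0, (1 - (expMulC (X : VecField P 0 (EuclideanSpace ℂ (Fin 3))) (coeField U₀) ⟨q.src, q.μ⟩ *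
    expMulC (X : VecField P 0 (EuclideanSpace ℂ (Fin 3))) (coeField U₀) ⟨q.src.shift q.μ, q.ν⟩ *
    Matrix.adjugate (expMulC (X : VecField P 0 (EuclideanSpace ℂ (Fin 3))) (coeField U₀) ⟨q.src.shift q.ν, q.μ⟩) *
    Matrix.adjugate (expMulC (X : VecField P 0 (EuclideanSpace ℂ (Fin 3))) (coeField U₀) ⟨q.src, q.ν⟩)).trace / 2))
include ha

/-- **THE SLICE DERIVATIVE OF THE COMPLEX ACTION ON A REAL DIRECTION IS THE (REAL) LINE DERIVATIVE OF THE WILSON ACTION**: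
`Da(0)⟨cplxVec p, _⟩ = ↑(d∕ds wilsonAction4 (expMul su2Chart (s • p) U₀)|₀)`, and the real curve is differentiable with that derivative.
[cite: Balaban1989LargeFieldII, (1.12) p.359 (first-order term); Balaban1985Variational, Sect. G p.305; Balaban1989LargeFieldI, Prop. 1 p.194 («real for real arguments»)] -/
theorem hasDerivAt_wilsonAction4_realLine {p : VecField P 0 E3} (hp : cplxVec p ∈ S) :
    HasDerivAt (fun s : ℝ => wilsonAction4 (expMul su2Chart (s • p) U₀)) (fderiv ℂ a 0 ⟨cplxVec p, hp⟩).re 0 ∧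
      (fderiv ℂ a 0 ⟨cplxVec p, hp⟩).im = 0 := by
  have hd : DifferentiableAt ℂ a 0 := (analyticAt_sliceAction S ha 0).differentiableAt
  have h1 := hasDerivAt_comp_realLine (x₀ := (0 : S)) (⟨cplxVec p, hp⟩ : S) hd
  have hfun : (fun t : ℝ => a ((0 : S) + (t : ℂ) • ⟨cplxVec p, hp⟩)) = fun t : ℝ => ((wilsonAction4 (expMul su2Chart (t • p) U₀) : ℝ) : ℂ) := by
    funext t; rw [zero_add, sliceAction_realLine S ha hp t]
  rw [hfun] at h1
  constructor
  · have hre := (Complex.reCLM.hasFDerivAt).comp_hasDerivAt (0 : ℝ) h1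
    simpa only [Function.comp_def, Complex.reCLM_apply, Complex.ofReal_re] using hre
  · have him := (Complex.imCLM.hasFDerivAt).comp_hasDerivAt (0 : ℝ) h1
    simp only [Function.comp_def, Complex.imCLM_apply, Complex.ofReal_im] at him
    exact him.unique (hasDerivAt_const (0 : ℝ) (0 : ℝ))

/-- `Da(0)⟨cplxVec p, _⟩ = ↑(deriv (s ↦ wilsonAction4 (expMul su2Chart (s • p) U₀)) 0)`. [cite: Balaban1989LargeFieldII, (1.12) p.359; Balaban1989LargeFieldI, Prop. 1 p.194] -/
theorem fderiv_sliceAction_apply_cplxVec {p : VecField P 0 E3} (hp : cplxVec p ∈ S) :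
    fderiv ℂ a 0 ⟨cplxVec p, hp⟩ = ((deriv (fun s : ℝ => wilsonAction4 (expMul su2Chart (s • p) U₀)) 0 : ℝ) : ℂ) := by
  obtain ⟨hre, him⟩ := hasDerivAt_wilsonAction4_realLine S ha hp
  apply Complex.ext
  · rw [Complex.ofReal_re, hre.deriv]
  · rw [Complex.ofReal_im, him]

/-- ★ **STATIONARITY OF THE WILSON ACTION ALONG REAL SLICE LINES ⇒ THE SLICE DERIVATIVE OF THE COMPLEX ACTION VANISHES** (`Da(0) = 0` on the conjugation-stable slice: it
vanishes on real directions by Fermat, hence everywhere by complex linearity — `ConstrainedCriticalFamilySymm.killsKer_of_real`).  At the FLAT base (`U₀` a global minimiser of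
`wilsonAction4`) the hypothesis holds for every `p`. [cite: Balaban1989LargeFieldII, p.357 («the background field identically equal to 1»), (1.12) p.359; Balaban1985Variational, Thm 1 (8) p.279] -/
theorem fderiv_sliceAction_eq_zero_of_isLocalMin (hS : ∀ X ∈ S, conjVec X ∈ S)
    (hmin0 : ∀ p : VecField P 0 E3, cplxVec p ∈ S → IsLocalMin (fun s : ℝ => wilsonAction4 (expMul su2Chart (s • p) U₀)) 0) :
    fderiv ℂ a 0 = 0 := by
  obtain ⟨cE, hcE, hcEinv⟩ := exists_conjCLM_submodule S hS
  have hreal : ∀ u : S, cE u = u → (0 : S →L[ℂ] S) u = 0 → fderiv ℂ a 0 u = 0 := by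
    intro u hu _
    have hureal : conjVec (u : VecField P 0 (EuclideanSpace ℂ (Fin 3))) = (u : VecField P 0 (EuclideanSpace ℂ (Fin 3))) := by
      rw [← hcE, hu]
    obtain ⟨p, hp⟩ := (conjVec_eq_self_iff _).1 hureal
    have hpS : cplxVec p ∈ S := by rw [← hp]; exact u.2
    have hu' : u = ⟨cplxVec p, hpS⟩ := Subtype.ext hp
    rw [hu', fderiv_sliceAction_apply_cplxVec S ha hpS, (hmin0 p hpS).deriv_eq_zero, Complex.ofReal_zero]
  have h := killsKer_of_real cE cE hcEinv (fderiv ℂ a 0) (0 : S →L[ℂ] S) (fun s => by simp) hreal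
  ext s
  exact h s (by simp)

omit ha in
/-- A GLOBAL minimiser of the Wilson action (the flat base: `wilsonAction4 ≥ 0 = wilsonAction4 1`) is stationary along every chart line. [cite: Balaban1985Variational, Thm 1 (8) p.279; Balaban1989LargeFieldII, p.357] -/
theorem isLocalMin_realLine_of_forall_le (hglob : ∀ U : GaugeField P 0 SU2, wilsonAction4 U₀ ≤ wilsonAction4 U) (p : VecField P 0 E3) :
    IsLocalMin (fun s : ℝ => wilsonAction4 (expMul su2Chart (s • p) U₀)) 0 := by
  refine Filter.Eventually.of_forall fun s => ?_
  show wilsonAction4 (expMul su2Chart ((0 : ℝ) • p) U₀) ≤ wilsonAction4 (expMul su2Chart (s • p) U₀)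
  rw [zero_smul, B16Sect1Backgrounds.expMul_zero]
  exact hglob _

omit ha in
/-- **AT AN UNCONSTRAINED STATIONARY BASE THE MULTIPLIER VANISHES**: `Da(0) = 0`, `DΦ₀(0)` onto, `Da(0) = ℓ₀ ∘ DΦ₀(0)` ⇒ `ℓ₀ = 0`. [cite: LuenbergerYe2008, §11.3 (first-order conditions; bookkeeping); Balaban1985Variational, (181) p.307] -/
theorem multiplier_eq_zero_of_fderiv_eq_zero {F : Type*} [NormedAddCommGroup F] [NormedSpace ℂ F] {a : S → ℂ} {Φ₀ : S → F}
    (ha0 : fderiv ℂ a 0 = 0) (honto : Function.Surjective (fderiv ℂ Φ₀ 0)) {ℓ₀ : F →L[ℂ] ℂ} (hℓ₀ : fderiv ℂ a 0 = ℓ₀.comp (fderiv ℂ Φ₀ 0)) :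
    ℓ₀ = 0 := by
  ext y
  obtain ⟨s, rfl⟩ := honto y
  have h := congrArg (fun T : S →L[ℂ] ℂ => T s) hℓ₀
  simp only [ha0, zero_apply, ContinuousLinearMap.coe_comp, Function.comp_apply] at h
  rw [zero_apply, ← h]

/-- ★★ **(β) AT A STATIONARY BASE FROM POSITIVITY OF THE PURE SECOND VARIATION** — the (β) letter of `hMin_[atRecord_]of_rightInverseLetters` (for EVERY multiplier `ℓ₀` of the base
state) from: stationarity of the Wilson action along the real slice lines at `U₀` (`isLocalMin_realLine_of_forall_le` at the flat base), «onto» (the lineage's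
`honto_of_rightInverse`), and `0 < d²∕dt² wilsonAction4 (expMul su2Chart (t • p) U₀)|₀` for every non-zero real slice field `p` in the kernel of the linearised constraint —
EXACTLY the flat-base currency of n12-w3's `deriv_deriv_pos_of_fderiv_msChart_one_eq_zero_of_transversal` ∕ n12-w4's near-flat lower bounds (up to their chart dictionaries).
[cite: Balaban1989LargeFieldII, (1.9) p.358, (1.12) p.359, p.359 («positive, hence invertible … implicit function theorem»); Balaban1985Variational, Sect. G pp.305–307, (181) p.307, Prop. 9 (190) p.309; LuenbergerYe2008, §10.7 p.307, §11.5] -/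
theorem hnondeg_slice_of_secondVariation_pos_of_isLocalMin (𝔹 : DetSet P) (k : ℕ) (W : MSField P SU2)
    (hsbU : SmallBelow (fun j => blockAvg (P := P) (j := j) expMeanLogSU) k U₀)
    (hU₀ : AgreeOn 𝔹 (avgFamily (fun j => blockAvg (P := P) (j := j) expMeanLogSU) U₀) W)
    (hS : ∀ X ∈ S, conjVec X ∈ S)
    (Φ₀ : S → Fin (constrCard 𝔹 k) → EuclideanSpace ℂ (Fin 3))
    (hΦ₀ : ∀ (X : S) i, Φ₀ X i = logCoordC (star ((W ((constrEnum 𝔹 k).symm i).1 ((constrEnum 𝔹 k).symm i).2.1 : SU2) : Matrix (Fin 2) (Fin 2) ℂ) *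
      iterMh ((constrEnum 𝔹 k).symm i).1 (expMulC (X : VecField P 0 (EuclideanSpace ℂ (Fin 3))) (coeField U₀)) ((constrEnum 𝔹 k).symm i).2.1))
    (hmin0 : ∀ p : VecField P 0 E3, cplxVec p ∈ S → IsLocalMin (fun s : ℝ => wilsonAction4 (expMul su2Chart (s • p) U₀)) 0)
    (honto : Function.Surjective (fderiv ℂ Φ₀ 0))
    (hpos : ∀ (p : VecField P 0 E3) (hp : cplxVec p ∈ S), p ≠ 0 → fderiv ℂ Φ₀ 0 ⟨cplxVec p, hp⟩ = 0 →
      0 < deriv (deriv (fun t : ℝ => wilsonAction4 (expMul su2Chart (t • p) U₀))) 0) :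
    ∀ ℓ₀ : (Fin (constrCard 𝔹 k) → EuclideanSpace ℂ (Fin 3)) →L[ℂ] ℂ, fderiv ℂ a 0 = ℓ₀.comp (fderiv ℂ Φ₀ 0) →
      ∀ s : S, fderiv ℂ Φ₀ 0 s = 0 →
        (∀ t : S, fderiv ℂ Φ₀ 0 t = 0 → fderiv ℂ (fderiv ℂ a) 0 s t - ℓ₀ (fderiv ℂ (fderiv ℂ Φ₀) 0 s t) = 0) → s = 0 := by
  intro ℓ₀ hℓ₀
  have ha0 : fderiv ℂ a 0 = 0 := fderiv_sliceAction_eq_zero_of_isLocalMin S ha hS hmin0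
  have hℓ : ℓ₀ = 0 := multiplier_eq_zero_of_fderiv_eq_zero S ha0 honto hℓ₀
  subst hℓ
  refine hnondeg_slice_of_realSecondVariation_pos 𝔹 k W hsbU hU₀ S hS a ha Φ₀ hΦ₀ 0 fun p hp hne hker => ?_
  have hfun : (fun t : ℝ => wilsonAction4 (expMul su2Chart (t • p) U₀) - ((0 : (Fin (constrCard 𝔹 k) → EuclideanSpace ℂ (Fin 3)) →L[ℂ] ℂ)
      (Φ₀ ((t : ℂ) • ⟨cplxVec p, hp⟩))).re) = fun t : ℝ => wilsonAction4 (expMul su2Chart (t • p) U₀) := by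
    funext t; rw [zero_apply, Complex.zero_re, sub_zero]
  rw [hfun]
  exact hpos p hp hne hker

end Stationary

end Literature.MathematicalPhysics.QuantumFieldTheory.Balaban1983to89.B15Prop1SliceNondegeneracyFromRealCoercive

end
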